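import Summits.QuantumFields.YangMills.Theorems.BalabanUVNodesN18Beta0LimitOfKernelLetters

/-!
# BalabanUVNodes ∕ N18 — THE CORNER OF THE U3 → U2 FACE IN LETTER CURRENCY, v₀-FREE: node U2's history moduli (⇐ N22's kernel NE9 + one (5.10) clause) give the
# CORNER NUMBERS `b_k = lim_{t→0⁺} β_k(t,…,t)` of the β-functions WITH THE LINEAR BAND `|β_k(p) − b_k| ≤ Σ_i |Λ k i|·p_i` on the whole box — hence DEF-1's per-scale
# anchor, a `k`-uniform O(γ₀) constant remainder under fading memory, the comparison with the (2.12) base-history numbers `beta0OfMerged β v₀`, the located sentence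
# «own-number anchoring ⟺ the off-box fill equals the corner»; record ∕ K4 editions WITHOUT the admissibility row `hadm`; a K1⁷ run-rows OFFER
# (Track A, DAG node N18 = NE5, its in-edge to N17 = node U3 → node U2; cluster K4 «SpineRates»; key K3⁷ `SpineGivenEndpointR13SepCoPH` = stmt-QuantumFields-20544,
# skeleton v5 941dddb108cbaacf; width seat `pub-ymgap-dag-n18-w1` g4, the successor piece of g3's «face g_k → 0⁺» files p606904 ∕ p608680 ∕ p609089)

HONEST FRAMING.  Count-neutral kernel bookkeeping BY NAME (`--kind proof --supports stmt-QuantumFields-20544 --as helper`).  Elementary real analysis on the boxes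
`]0, γ]^{k+1}` (ℝ complete; g3's one-variable McShane lemma on the DIAGONAL) composed BY NAME with LANDED lemmas of dag-n22-w3 (`histLipschitz_betaMerged_of_ne9`,
`histLipschitz_betaOfRecord₁₃_of_kernelNE9`, `fadingMemory_histModuli_of_fadingMemory`), dag-n17-w3 (`histLipschitz_of_readOutAt_n22`) and this lineage's g3
(`exists_tendsto_nhdsGT_zero_of_lipschitzOnWith_Ioc`, `beta0LimitExists_of_histLipschitz`, `tendsto_beta0OfMerged`).  `HistLipschitz`, kernel NE9, the (5.10) clause, `ReadOutAt`,
`N22At`, fading memory are DISPLAYED HYPOTHESES — nothing of Bałaban's is asserted, inhabited or discharged; NO corner SIGN, NO identification of the corner numbers with any named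
one-loop numbers, NO drift value is claimed; N17 ∕ N18 ∕ N22 NOT discharged; K3⁷ OPEN (v5), `stub_rates13H` ∕ `stub_expansion13H` NOT proved; K1⁷ ∕ K2⁷ served BY NAME only
(nothing registered, no skeleton touched).  Counts UNMOVED (typed 28∕28 · discharged 5∕27, A 5∕28).  One finite four-torus programme at fixed `ε`, Bałaban AS PRINTED; route R4
closes ONLY the conditional finite-𝕋⁴ rung `BalabanLadder.UV` — NOT the continuum limit, NOT ℝ⁴, NOT OS, NOT the Yang–Mills mass gap, NOT Clay.  THEOREMS ONLY: 0 `def`,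
0 `instance`, 0 `sorry`, standard axioms.  PRIORITY ∕ CREDIT (R455 (A)): the EXISTENCE of a per-scale anchor from `HistLipschitz` is ym-nodeO PORT-1's
`BalabanUVNodesK2CornerRoadSign.exists_scaleAnchor_of_histLipschitz` (p609637, 2026-08-28) after idea-7's `Cruxes/EndpointGivenBR13SepCoPH/CornerLimitSignSketch.lean` §1
(`cornerAnchor_of_histLipschitz`, CRIT-2 ROUND 2c J2 «ScaleAnchor ⟺ CornerAnchor»); anchor UNIQUENESS is b2b-an4's `eq_of_anchors` (`…K2Line1PrimeRemainderPrice`); the SHAPES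
`ScaleAnchor` ∕ `ConstRemainder` ∕ `RunConstRemainder` are ym-nodeO DEF-1's (`…K2NamedJetsRemAt` p593586 ∕ `…RunRemAt` p596574) — all CITED, none re-declared: this file spells
the anchor ∕ remainder shapes INLINE (they δ-unfold to DEF-1's `def`s) so that it imports nothing from the K2⁷ ∕ Theses cone.  What THIS file adds: the LINEAR BAND as a theorem,
the ONE-VARIABLE (diagonal) reading of the corner numbers, the comparison with def-B's (2.12) object `beta0OfMerged`, the own-numbers sentence, and the record ∕ K4 ∕ K1 editions.

WHY.  g3 closed the face `g_k → 0⁺` of the node U3 → node U2 edge AT an admissible base history `θ.v₀` (the 32 consumers' `hlim`, CRIT-2's exposed object `beta0OfMerged β_m θ.v₀`,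
the v₀-referenced O(γ) remainder band) and surfaced ONE located input: `hadm : θ.v₀ ∈ ]0, θ.γ]` — read by NO admissibility clause, FALSE at the records of record (`v₀ := 0`).
The v₀-FREE currency the β sub-cell converged on the same morning (director-ym №206 (3), PORT-1's corner road p599976 ∕ p607079 ∕ p609637, plan g84 K2V7-PRECUT) is the CORNER:
the limits of `β_k` as ALL couplings go to `0⁺` inside the box.  Under N22's kernel letters these limits exist AND come with an explicit linear band; everything g3 did at `θ.v₀`
has a v₀-free corner twin WITHOUT `hadm`, and the two are Lipschitz-close inside the window.  That is this file.

WHAT (theorems only).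
* §1 node U2 currency (ANY `HBeta`; moduli sign-free through `|Λ k i|`): `const_mem_box` · `lipschitzOnWith_diag_of_histLipschitz` (the diagonal section is `S_k`-Lipschitz,
  `S_k := Σ_i |Λ k i|`) · `sum_moduli_abs_sub_const_le` · `exists_level_below` · ★ `exists_cornerNumbers_of_histLipschitz` (`0 < γ`, `HistLipschitz Λ γ β` ⟹ ∃ b, the DIAGONAL
  LIMITS `β_k(t,…,t) → b_k` (`t → 0⁺`) ∧ the LINEAR BAND `|β_k(p) − b_k| ≤ Σ_i |Λ k i|·p_i` on `]0,γ]^{k+1}`) · ★ `abs_sub_le_sum_of_anchor_of_histLipschitz` (the band for ANY per-scale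
  anchor) · `anchor_of_band` (band ⟹ anchor, radius `min γ (δ∕(S_k+1))`) · `tendsto_diag_of_anchor_of_histLipschitz` (anchor numbers ARE the diagonal limits) · `abs_sub_le_mul_of_band`
  (`ConstRemainder β b (S_k γ₀) γ₀`-shape ∀ γ₀ ≤ γ) · `sum_abs_moduli_le_of_fadingMemory` · ★ `abs_sub_le_band_of_fadingMemory` (`FadingMemory C θ Λ`, `θ < 1` ⟹ `r = C(1−θ)⁻¹γ₀` UNIFORM
  in `k`) · `anchor_congr_box` · ★ `abs_beta0OfMerged_sub_anchor_le_of_histLipschitz` (ADMISSIBLE `v₀`: `|beta0OfMerged β v₀ k − b_k| ≤ Σ_{i<k} |Λ k i|·v₀ k i`) ·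
  `abs_beta0OfMerged_sub_beta0OfMerged_le_of_histLipschitz` (two admissible base histories: `≤ Σ_{i<k} |Λ k i|·|v₀ − v₀′|` — CRIT-2's base-history dependence QUANTIFIED) ·
  ★ `anchor_zeroValues_betaOfMerged_iff` (def-B's design `betaOfMerged βm β0 γ`: anchored at its OWN zero-history values ⟺ `β0 = b`).
FILE 2 (`…N18CornerBandOfKernelLettersRecord`, the 400-line rule) carries the editions:
* §2 generic term family (W1-19 objects): `betaPrime510_nonneg` · ★ `exists_cornerNumbers_betaMerged_of_ne9` · `abs_betaMerged_sub_corner_le_band_of_ne9_fadingMemory`.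
* §3 AT THE RECORD, Stage 13, from K3⁷ v5 §2b (i)∕(iii)'s `h9` ∕ `hdec` VERBATIM, NO `hadm`: ★★ `exists_cornerNumbers_betaOfRecord₁₃_of_kernelNE9` · ★★ `anchor_betaOfRecord₁₃_of_kernelNE9`
  (= the `hA` of v5 §2b (ii′) `sensitive_rrOfRecord_of_pinned_of_anchor` ∕ §4 (iv) `betaOfRecord_eq_anchor_of_guardedReading_of_blind`, DISCHARGED from (i)+(iii)) ·
  `abs_betaOfRecord₁₃_sub_corner_le_band_of_kernelNE9_letters` (ℓ.Signs edition, `r = betaPrime510 4 1 ℓ.κ·ℓ.C₉·ℓ.ω·(1−ℓ.ω)⁻¹·γ₀`, k-uniform) ·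
  `abs_beta0OfMerged_record_sub_corner_le_of_kernelNE9_letters` (the consumers' (2.12) numbers at admissible `θ.v₀` lie within `…·θ.γ` of the corner numbers).
* §4 K3⁷ ∕ K4 carriers (`ReadOutAt D u ∧ N22At u`, ANY carriers, N18 idle): ★★ `exists_cornerNumbers_βfun_of_readOutAt_n22` · `abs_βfun_sub_corner_le_band_of_readOutAt_n22` ·
  ★★ `exists_cornerNumbers_betaOfRecord₁₃_of_readOutAt_n22_rateCarriersOfRecord₁₃CoPH` (at K3⁷ v5's bundle of record: under stub 1's (D4) ∧ N22 conjuncts the β of record is anchored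
  at its corner numbers — K2⁷'s corner-road input and K3⁷ §4 (iv)'s `hA` come for free).
* §5 SERVED BY NAME, an OFFER in generic currency: `prefixOf_mem_histBox` · ★ `runRows_of_band_floor_ceiling` (k-uniform band + ceiling `U < βup` + eventual corner FLOOR `e > 0`
  ⟹ the β-rows of K1⁷ v6 `stub_runRows13PWS` in BOX form, reference sequence = the corner numbers; run rows by DEF-1's `runConstRemainder_of_constRemainder`).

References (TYPES ∕ locators only; nothing printed is used as a hypothesis): [I] = T. Bałaban, Commun. Math. Phys. **109** (1987) 249–301 [Balaban1987RG1]: Thm 3 p. 264,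
(1.20)–(1.22) p. 264, (2.12)–(2.14) p. 268, §5 p. 298 («β_j depends also on all preceding coupling constants» — the moduli are UNPRINTED binders), (5.10) p. 293.
McShane extension (Mathlib `LipschitzOnWith.extend_real`) via g3's §1 lemma.
-/

noncomputable section

open Filter Topology
open scoped BigOperators NNReal

namespace YMDAG.N18.CornerBandOfKernelLetters

open Literature.MathematicalPhysics.QuantumFieldTheory.Balaban1983to89
open Literature.MathematicalPhysics.QuantumFieldTheory.Balaban1983to89.T4Continuum (T4Family ULoop)
open Literature.MathematicalPhysics.QuantumFieldTheory.Balaban1983to89.T4OutputRate (Window NE9)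
open Literature.MathematicalPhysics.QuantumFieldTheory.Balaban1983to89.FlowStep (Box HBeta mem_box prefixOf histBox_eq_box)
open Literature.MathematicalPhysics.QuantumFieldTheory.Balaban1983to89.B12Beta (HistBox)
open Literature.MathematicalPhysics.QuantumFieldTheory.Balaban1983to89.T4CouplingMatching (HistLipschitz FadingMemory)
open Literature.MathematicalPhysics.QuantumFieldTheory.Balaban1983to89.Node00 (TermFamily1 betaMerged betaOfMerged beta0OfMerged Beta0LimitExists
  tendsto_beta0OfMerged betaOfMerged_of_mem betaOfMerged_of_notMem mergedTermFamilyMatT TβOfRecord₁₃ TcanOfRecord chiβOfRecord₁₃ betaOfRecord₁₃ Stage13Params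
  Stage13HParams U3Letters₁₁ datumOfRecord₁₃CoPH)
open Literature.MathematicalPhysics.QuantumFieldTheory.Balaban1983to89.Node00.U3OfKernels (EA objectsOfRecord₁₃ KernelDecay KernelDecayOfRecord₁₃)
open Literature.MathematicalPhysics.QuantumFieldTheory.Balaban1983to89.B12Sec2to5 (betaPrime510)
open YMDAG.UVSplit (U3Carriers N22At ReadOutAt Datum RateReading₁₃CoPH rateCarriersOfRecord₁₃CoPH u3OfRecord₁₃)
open YMDAG.N22.AtKernels (histLipschitz_betaMerged_of_ne9 histLipschitz_betaOfMerged_of_ne9 fadingMemory_histModuli_of_fadingMemory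
  histLipschitz_betaOfRecord₁₃_of_kernelNE9 histLipschitz_fadingMemory_betaOfRecord₁₃_of_kernelNE9)
open YMDAG.N17.HistModuliCont (histLipschitz_of_readOutAt_n22)
open YMDAG.N18.Beta0LimitOfKernelLetters (exists_tendsto_nhdsGT_zero_of_lipschitzOnWith_Ioc update_last_mem_box beta0LimitExists_of_histLipschitz)

/-! ## §1 Node U2 currency (ANY `HBeta`): the corner numbers, the linear band, the anchor, the uniform remainder, the base-history comparison -/

section U2

variable {β : HBeta} {Λ : ℕ → ℕ → ℝ} {γ : ℝ} {b : ℕ → ℝ}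

/-- The constant (DIAGONAL) history `(t, …, t)` lies in the box `]0, γ]^{k+1}` iff `t ∈ ]0, γ]`. [folklore] -/
theorem const_mem_box {k : ℕ} {t : ℝ} (ht : t ∈ Set.Ioc 0 γ) : (fun _ : Fin (k + 1) => t) ∈ Box γ k :=
  mem_box.2 fun _ => ht

/-- **THE DIAGONAL SECTION IS LIPSCHITZ**: under `HistLipschitz Λ γ β` the one-variable section `t ↦ β k (t, …, t)` is Lipschitz on `]0, γ]` with constant
`S_k := Σ_i |Λ k i|` (the total modulus of scale `k`). [cite: Balaban1987RG1, §5 p.298 (the moduli are binders; bookkeeping)] -/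
theorem lipschitzOnWith_diag_of_histLipschitz (hL : HistLipschitz Λ γ β) (k : ℕ) :
    LipschitzOnWith (Real.toNNReal (∑ i : Fin (k + 1), |Λ k i|)) (fun t : ℝ => β k (fun _ : Fin (k + 1) => t)) (Set.Ioc 0 γ) := by
  have hS0 : 0 ≤ ∑ i : Fin (k + 1), |Λ k i| := Finset.sum_nonneg fun i _ => abs_nonneg _
  refine LipschitzOnWith.of_dist_le_mul fun x hx y hy => ?_
  rw [Real.dist_eq, Real.dist_eq, Real.coe_toNNReal _ hS0]
  calc |β k (fun _ => x) - β k (fun _ => y)| ≤ ∑ i : Fin (k + 1), Λ k i * |x - y| := hL k _ _ (const_mem_box hx) (const_mem_box hy)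
    _ ≤ ∑ i : Fin (k + 1), |Λ k i| * |x - y| :=
        Finset.sum_le_sum fun i _ => mul_le_mul_of_nonneg_right (le_abs_self _) (abs_nonneg _)
    _ = (∑ i : Fin (k + 1), |Λ k i|) * |x - y| := by rw [Finset.sum_mul]

/-- Bookkeeping: the modulus sum against a box history `p` compared with a diagonal history `(t,…,t)` BELOW it (`t ≤ p_i` for all `i`) is
`≤ Σ_i |Λ k i|·p_i − S_k·t`. [folklore] -/
theorem sum_moduli_abs_sub_const_le {k : ℕ} {p : Fin (k + 1) → ℝ} {t : ℝ} (ht : ∀ i, t ≤ p i) :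
    ∑ i : Fin (k + 1), Λ k i * |p i - t| ≤ ∑ i : Fin (k + 1), |Λ k i| * p i - (∑ i : Fin (k + 1), |Λ k i|) * t := by
  rw [Finset.sum_mul, ← Finset.sum_sub_distrib]
  refine Finset.sum_le_sum fun i _ => ?_
  have h1 : |p i - t| = p i - t := abs_of_nonneg (sub_nonneg.2 (ht i))
  calc Λ k i * |p i - t| ≤ |Λ k i| * |p i - t| := mul_le_mul_of_nonneg_right (le_abs_self _) (abs_nonneg _)
    _ = |Λ k i| * p i - |Λ k i| * t := by rw [h1, mul_sub]

/-- Below every box history there is a small admissible level: for `p ∈ ]0, γ]^{k+1}` and `γ′ > 0` some `t ∈ ]0, γ′]` has `t ≤ p_i` for all `i`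
(finitely many neighbourhoods of `0⁺`). [folklore] -/
theorem exists_level_below {k : ℕ} {p : Fin (k + 1) → ℝ} (hp : p ∈ Box γ k) {γ' : ℝ} (hγ' : 0 < γ') :
    ∃ t : ℝ, t ∈ Set.Ioc 0 γ' ∧ ∀ i, t ≤ p i := by
  have h1 : ∀ᶠ t in 𝓝[>] (0 : ℝ), ∀ i : Fin (k + 1), t ∈ Set.Ioc 0 (p i) :=
    eventually_all.2 fun i => Ioc_mem_nhdsGT ((mem_box.1 hp) i).1
  have h2 : ∀ᶠ t in 𝓝[>] (0 : ℝ), t ∈ Set.Ioc 0 γ' := Ioc_mem_nhdsGT hγ'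
  obtain ⟨t, ht1, ht2⟩ := (h1.and h2).exists
  exact ⟨t, ht2, fun i => (ht1 i).2⟩

/-- ★ **THE CORNER NUMBERS AND THE LINEAR BAND FROM NODE U2's HISTORY MODULI** (v₀-FREE).  If `β` is history-Lipschitz on the boxes `]0, γ]^{k+1}`
(`0 < γ`, ANY moduli `Λ`), then there are numbers `b_k` — the limits of the DIAGONAL sections `t ↦ β_k(t, …, t)` as `t → 0⁺` — with
`|β_k(p) − b_k| ≤ Σ_i |Λ k i|·p_i` for EVERY box history `p`.  (ℝ complete: g3's one-variable McShane lemma on the diagonal; then the moduli once more against a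
diagonal history below `p`.)  Existence of a per-scale anchor ALONE is ym-nodeO PORT-1's `…K2CornerRoadSign.exists_scaleAnchor_of_histLipschitz` (p609637) ∕ idea-7's
`Cruxes/…/CornerLimitSignSketch.lean` §1 — cited; the BAND and the one-variable reading of the numbers are what this file adds.  No reference history `v₀`, no
admissibility row. [cite: Balaban1987RG1, (2.12)-(2.14) p.268 and §5 p.298] -/
theorem exists_cornerNumbers_of_histLipschitz (hγ : 0 < γ) (hL : HistLipschitz Λ γ β) :
    ∃ b : ℕ → ℝ, (∀ k : ℕ, Tendsto (fun t : ℝ => β k (fun _ : Fin (k + 1) => t)) (𝓝[>] (0 : ℝ)) (𝓝 (b k))) ∧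
      ∀ (k : ℕ) (p : Fin (k + 1) → ℝ), p ∈ Box γ k → |β k p - b k| ≤ ∑ i : Fin (k + 1), |Λ k i| * p i := by
  choose b hb using fun k => exists_tendsto_nhdsGT_zero_of_lipschitzOnWith_Ioc hγ (lipschitzOnWith_diag_of_histLipschitz hL k)
  refine ⟨b, fun k => (hb k).1, fun k p hp => ?_⟩
  have hS0 : 0 ≤ ∑ i : Fin (k + 1), |Λ k i| := Finset.sum_nonneg fun i _ => abs_nonneg _
  obtain ⟨t, ht, htp⟩ := exists_level_below hp hγ
  have htγ : t ∈ Set.Ioc 0 γ := ht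
  have h1 : |β k p - β k (fun _ => t)| ≤ ∑ i : Fin (k + 1), Λ k i * |p i - t| := hL k _ _ hp (const_mem_box htγ)
  have h2 : |β k (fun _ => t) - b k| ≤ (∑ i : Fin (k + 1), |Λ k i|) * t := by
    have h := (hb k).2 t htγ
    rwa [Real.coe_toNNReal _ hS0] at h
  calc |β k p - b k| ≤ |β k p - β k (fun _ => t)| + |β k (fun _ => t) - b k| := abs_sub_le _ _ _
    _ ≤ (∑ i : Fin (k + 1), |Λ k i| * p i - (∑ i : Fin (k + 1), |Λ k i|) * t) + (∑ i : Fin (k + 1), |Λ k i|) * t :=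
        add_le_add (h1.trans (sum_moduli_abs_sub_const_le htp)) h2
    _ = ∑ i : Fin (k + 1), |Λ k i| * p i := by ring

/-- ★ **THE LINEAR BAND FOR ANY PER-SCALE ANCHOR** (DEF-1's `ScaleAnchor β b`, unfolded; by an4's `eq_of_anchors` the anchor numbers are unique, so they ARE the corner
numbers): `HistLipschitz Λ γ β` and «for every `k`, `δ > 0` some box `]0, γ′]^{k+1}` on which `|β_k − b_k| ≤ δ`» give `|β_k(p) − b_k| ≤ Σ_i |Λ k i|·p_i` on the WHOLE box
`]0, γ]^{k+1}` — the anchor radius is immaterial, the moduli carry the bound out to the window.  [cite: Balaban1987RG1, (2.12)-(2.14) p.268 and §5 p.298] -/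
theorem abs_sub_le_sum_of_anchor_of_histLipschitz (hL : HistLipschitz Λ γ β)
    (hb : ∀ (k : ℕ) (δ : ℝ), 0 < δ → ∃ γ' : ℝ, 0 < γ' ∧ ∀ p : Fin (k + 1) → ℝ, p ∈ HistBox γ' k → |β k p - b k| ≤ δ)
    (k : ℕ) {p : Fin (k + 1) → ℝ} (hp : p ∈ Box γ k) : |β k p - b k| ≤ ∑ i : Fin (k + 1), |Λ k i| * p i := by
  have hS0 : 0 ≤ ∑ i : Fin (k + 1), |Λ k i| := Finset.sum_nonneg fun i _ => abs_nonneg _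
  refine le_of_forall_pos_le_add fun δ hδ => ?_
  obtain ⟨γ', hγ', hanchor⟩ := hb k δ hδ
  obtain ⟨t, ht, htp⟩ := exists_level_below hp hγ'
  have htγ : t ∈ Set.Ioc 0 γ := ⟨ht.1, (htp 0).trans ((mem_box.1 hp) 0).2⟩
  have h1 : |β k p - β k (fun _ => t)| ≤ ∑ i : Fin (k + 1), Λ k i * |p i - t| := hL k _ _ hp (const_mem_box htγ)
  have h2 : |β k (fun _ => t) - b k| ≤ δ := hanchor _ fun _ => ht
  calc |β k p - b k| ≤ |β k p - β k (fun _ => t)| + |β k (fun _ => t) - b k| := abs_sub_le _ _ _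
    _ ≤ (∑ i : Fin (k + 1), |Λ k i| * p i - (∑ i : Fin (k + 1), |Λ k i|) * t) + δ :=
        add_le_add (h1.trans (sum_moduli_abs_sub_const_le htp)) h2
    _ ≤ ∑ i : Fin (k + 1), |Λ k i| * p i + δ := by nlinarith [mul_nonneg hS0 ht.1.le]

/-- **BAND ⇒ ANCHOR**: a linear band `|β_k(p) − b_k| ≤ Σ_i |Λ k i|·p_i` on `]0, γ]^{k+1}` (`0 < γ`) makes `b` a per-scale anchor of `β` — radius `min γ (δ∕(S_k + 1))` —
i.e. DEF-1's `ScaleAnchor β b` (unfolded). [folklore] -/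
theorem anchor_of_band (hγ : 0 < γ) (hband : ∀ (k : ℕ) (p : Fin (k + 1) → ℝ), p ∈ Box γ k → |β k p - b k| ≤ ∑ i : Fin (k + 1), |Λ k i| * p i) :
    ∀ (k : ℕ) (δ : ℝ), 0 < δ → ∃ γ' : ℝ, 0 < γ' ∧ ∀ p : Fin (k + 1) → ℝ, p ∈ HistBox γ' k → |β k p - b k| ≤ δ := by
  intro k δ hδ
  set S : ℝ := ∑ i : Fin (k + 1), |Λ k i| with hS
  have hS0 : 0 ≤ S := Finset.sum_nonneg fun i _ => abs_nonneg _
  refine ⟨min γ (δ / (S + 1)), lt_min hγ (by positivity), fun p hp => ?_⟩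
  have hpγ : p ∈ Box γ k := mem_box.2 fun i => ⟨(hp i).1, (hp i).2.trans (min_le_left _ _)⟩
  calc |β k p - b k| ≤ ∑ i : Fin (k + 1), |Λ k i| * p i := hband k p hpγ
    _ ≤ ∑ i : Fin (k + 1), |Λ k i| * (δ / (S + 1)) :=
        Finset.sum_le_sum fun i _ => mul_le_mul_of_nonneg_left ((hp i).2.trans (min_le_right _ _)) (abs_nonneg _)
    _ = S * (δ / (S + 1)) := by rw [Finset.sum_mul]
    _ ≤ δ := by rw [mul_div_assoc']; exact (div_le_iff₀ (by positivity)).mpr (by nlinarith)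

/-- **THE ANCHOR NUMBERS ARE THE DIAGONAL LIMITS** (v₀-free, ONE real variable): under `HistLipschitz Λ γ β` (`0 < γ`) a per-scale anchor `b` of `β` satisfies
`β_k(t, …, t) → b_k` as `t → 0⁺` — so every desk can COMPUTE the corner numbers along the diagonal; no base history, no `limUnder` along an off-box ray. [folklore] -/
theorem tendsto_diag_of_anchor_of_histLipschitz (hγ : 0 < γ) (hL : HistLipschitz Λ γ β)
    (hb : ∀ (k : ℕ) (δ : ℝ), 0 < δ → ∃ γ' : ℝ, 0 < γ' ∧ ∀ p : Fin (k + 1) → ℝ, p ∈ HistBox γ' k → |β k p - b k| ≤ δ) (k : ℕ) :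
    Tendsto (fun t : ℝ => β k (fun _ : Fin (k + 1) => t)) (𝓝[>] (0 : ℝ)) (𝓝 (b k)) := by
  set S : ℝ := ∑ i : Fin (k + 1), |Λ k i| with hS
  have key : ∀ᶠ t in 𝓝[>] (0 : ℝ), ‖β k (fun _ : Fin (k + 1) => t) - b k‖ ≤ S * t := by
    filter_upwards [Ioc_mem_nhdsGT hγ] with t ht
    rw [Real.norm_eq_abs]
    refine (abs_sub_le_sum_of_anchor_of_histLipschitz hL hb k (const_mem_box ht)).trans (le_of_eq ?_)
    rw [Finset.sum_mul]
  have h0 : Tendsto (fun t : ℝ => S * t) (𝓝[>] (0 : ℝ)) (𝓝 0) := by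
    have h : Tendsto (fun t : ℝ => S * t) (𝓝 (0 : ℝ)) (𝓝 (S * 0)) := (continuous_const.mul continuous_id).tendsto 0
    rw [mul_zero] at h
    exact h.mono_left nhdsWithin_le_nhds
  exact tendsto_sub_nhds_zero_iff.1 (squeeze_zero_norm' key h0)

/-- **BAND ⇒ CONSTANT REMAINDER ON EVERY SUB-BOX**: on `]0, γ₀]^{k+1}` (`γ₀ ≤ γ`) the band gives `|β_k(p) − b_k| ≤ S_k·γ₀` — DEF-1's `ConstRemainder β b (S_k γ₀) γ₀` scale by
scale; the remainder SHRINKS with the box (contrast g3's v₀-referenced O(γ) band). [folklore] -/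
theorem abs_sub_le_mul_of_band (hband : ∀ (k : ℕ) (p : Fin (k + 1) → ℝ), p ∈ Box γ k → |β k p - b k| ≤ ∑ i : Fin (k + 1), |Λ k i| * p i)
    {γ₀ : ℝ} (hγ₀ : γ₀ ≤ γ) (k : ℕ) {p : Fin (k + 1) → ℝ} (hp : p ∈ HistBox γ₀ k) :
    |β k p - b k| ≤ (∑ i : Fin (k + 1), |Λ k i|) * γ₀ := by
  have hpγ : p ∈ Box γ k := mem_box.2 fun i => ⟨(hp i).1, (hp i).2.trans hγ₀⟩
  calc |β k p - b k| ≤ ∑ i : Fin (k + 1), |Λ k i| * p i := hband k p hpγ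
    _ ≤ ∑ i : Fin (k + 1), |Λ k i| * γ₀ := Finset.sum_le_sum fun i _ => mul_le_mul_of_nonneg_left (hp i).2 (abs_nonneg _)
    _ = (∑ i : Fin (k + 1), |Λ k i|) * γ₀ := by rw [Finset.sum_mul]

/-- **THE TOTAL MODULUS UNDER FADING MEMORY** (|·|-form used by the bands of this file): `FadingMemory C θ Λ` (`0 ≤ θ < 1`) gives `Σ_{i ≤ k} |Λ k i| ≤ C∕(1 − θ)`
UNIFORMLY IN `k` (the moduli are `≥ 0`; reflect the index, geometric series).  g3's `…RemainderBandOfKernelLetters.sum_moduli_le_of_fadingMemory` is the signed twin. [folklore] -/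
theorem sum_abs_moduli_le_of_fadingMemory {C θ : ℝ} (hΛ : FadingMemory C θ Λ) (hθ0 : 0 ≤ θ) (hθ1 : θ < 1) (k : ℕ) :
    ∑ i : Fin (k + 1), |Λ k i| ≤ C * (1 - θ)⁻¹ := by
  have hC : 0 ≤ C := by
    have h00 := hΛ 0 0 le_rfl
    simpa using h00.1.trans h00.2
  have step : ∑ i : Fin (k + 1), |Λ k i| ≤ ∑ i : Fin (k + 1), C * θ ^ (k - i) := Finset.sum_le_sum fun i _ => by
    have h := hΛ k i (Nat.le_of_lt_succ i.isLt)
    rw [abs_of_nonneg h.1]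
    exact h.2
  refine step.trans ?_
  have hrefl : ∑ i ∈ Finset.range (k + 1), θ ^ (k - i) = ∑ i ∈ Finset.range (k + 1), θ ^ i := by
    have h := Finset.sum_range_reflect (fun i => θ ^ i) (k + 1)
    simpa only [Nat.add_sub_cancel] using h
  have hgeom : ∑ i : Fin (k + 1), θ ^ (k - (i : ℕ)) ≤ (1 - θ)⁻¹ := by
    rw [Fin.sum_univ_eq_sum_range (fun i => θ ^ (k - i)) (k + 1), hrefl]
    exact sum_le_hasSum _ (fun i _ => pow_nonneg hθ0 i) (hasSum_geometric_of_lt_one hθ0 hθ1)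
  calc ∑ i : Fin (k + 1), C * θ ^ (k - (i : ℕ)) = C * ∑ i : Fin (k + 1), θ ^ (k - (i : ℕ)) := by rw [Finset.mul_sum]
    _ ≤ C * (1 - θ)⁻¹ := mul_le_mul_of_nonneg_left hgeom hC

/-- ★ **… UNIFORMLY IN THE SCALE UNDER FADING MEMORY**: with `FadingMemory C θ Λ` (`0 ≤ θ < 1`) the band gives `|β_k(p) − b_k| ≤ C·(1−θ)⁻¹·γ₀` on EVERY
`]0, γ₀]^{k+1}`, `γ₀ ≤ γ`, for EVERY `k` — DEF-1's `ConstRemainder β b (C(1−θ)⁻¹γ₀) γ₀` with ONE constant for all scales, relative to the CORNER numbers, base-history-free.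
[cite: Balaban1987RG1, (2.12)-(2.14) p.268 and §5 p.298] -/
theorem abs_sub_le_band_of_fadingMemory (hband : ∀ (k : ℕ) (p : Fin (k + 1) → ℝ), p ∈ Box γ k → |β k p - b k| ≤ ∑ i : Fin (k + 1), |Λ k i| * p i)
    {C θ : ℝ} (hΛ : FadingMemory C θ Λ) (hθ0 : 0 ≤ θ) (hθ1 : θ < 1) {γ₀ : ℝ} (hγ₀ : γ₀ ≤ γ) (k : ℕ) {p : Fin (k + 1) → ℝ} (hp : p ∈ HistBox γ₀ k) :
    |β k p - b k| ≤ C * (1 - θ)⁻¹ * γ₀ := by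
  have hγ₀0 : 0 ≤ γ₀ := (hp 0).1.le.trans (hp 0).2
  calc |β k p - b k| ≤ (∑ i : Fin (k + 1), |Λ k i|) * γ₀ := abs_sub_le_mul_of_band hband hγ₀ k hp
    _ ≤ C * (1 - θ)⁻¹ * γ₀ := mul_le_mul_of_nonneg_right (sum_abs_moduli_le_of_fadingMemory hΛ hθ0 hθ1 k) hγ₀0

/-- **ANCHORS TRANSFER ALONG AGREEMENT ON THE BOXES** (shrink the radius into the window): two families equal on every `]0, γ]^{k+1}` (`0 < γ`) have the same
per-scale anchors.  (an4's `anchor_congr_of_eqOn` in `HistBox` currency; here in `Box` currency for def-B's `betaOfMerged_of_mem`.) [folklore] -/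
theorem anchor_congr_box {β' : HBeta} (hγ : 0 < γ) (h : ∀ (k : ℕ) (p : Fin (k + 1) → ℝ), p ∈ Box γ k → β' k p = β k p)
    (hb : ∀ (k : ℕ) (δ : ℝ), 0 < δ → ∃ γ' : ℝ, 0 < γ' ∧ ∀ p : Fin (k + 1) → ℝ, p ∈ HistBox γ' k → |β k p - b k| ≤ δ) :
    ∀ (k : ℕ) (δ : ℝ), 0 < δ → ∃ γ' : ℝ, 0 < γ' ∧ ∀ p : Fin (k + 1) → ℝ, p ∈ HistBox γ' k → |β' k p - b k| ≤ δ := by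
  intro k δ hδ
  obtain ⟨γ', hγ', hanchor⟩ := hb k δ hδ
  refine ⟨min γ' γ, lt_min hγ' hγ, fun p hp => ?_⟩
  have hpγ : p ∈ Box γ k := mem_box.2 fun i => ⟨(hp i).1, (hp i).2.trans (min_le_right _ _)⟩
  rw [h k p hpγ]
  exact hanchor p fun i => ⟨(hp i).1, (hp i).2.trans (min_le_left _ _)⟩

/-- ★ **THE (2.12) BASE-HISTORY NUMBERS VERSUS THE CORNER NUMBERS.**  At an ADMISSIBLE reference-history family `v₀` (entries in `]0, γ]` — the row `hadm` of g3's
`beta0LimitExists_of_histLipschitz`), the one-sided last-coupling limits `beta0OfMerged β v₀ k = lim_{g→0⁺} β_k(v₀₀, …, v₀ₖ₋₁, g)` (def-B's (2.12) object, the `β⁰`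
field of the record's definitional split) differ from the anchor numbers by AT MOST the early-coupling moduli against the base history:
`|beta0OfMerged β v₀ k − b_k| ≤ Σ_{i<k} |Λ k i|·v₀ k i` — the LAST coordinate is absent (both numbers send it to `0⁺`).  This QUANTIFIES the base-history dependence that
CRIT-2's negative p592695 (`…Anchor13FalseOfTwoBaseHistories`) exhibits: inside the window it is Lipschitz-small, O(‖v₀‖); it is NOT zero in general.
[cite: Balaban1987RG1, (2.12)-(2.14) p.268 and §5 p.298] -/
theorem abs_beta0OfMerged_sub_anchor_le_of_histLipschitz (hL : HistLipschitz Λ γ β)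
    (hb : ∀ (k : ℕ) (δ : ℝ), 0 < δ → ∃ γ' : ℝ, 0 < γ' ∧ ∀ p : Fin (k + 1) → ℝ, p ∈ HistBox γ' k → |β k p - b k| ≤ δ)
    {v₀ : (k : ℕ) → (Fin (k + 1) → ℝ)} (hadm : ∀ k i, 0 < v₀ k i ∧ v₀ k i ≤ γ) (k : ℕ) :
    |beta0OfMerged β v₀ k - b k| ≤ ∑ i : Fin k, |Λ k (Fin.castSucc i)| * v₀ k (Fin.castSucc i) := by
  have hγ : 0 < γ := (hadm k (Fin.last k)).1.trans_le (hadm k (Fin.last k)).2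
  have ht := tendsto_beta0OfMerged β v₀ (beta0LimitExists_of_histLipschitz hL hadm) k
  set A : ℝ := ∑ i : Fin k, |Λ k (Fin.castSucc i)| * v₀ k (Fin.castSucc i) with hA
  have hev : ∀ᶠ g in 𝓝[>] (0 : ℝ), |β k (Function.update (v₀ k) (Fin.last k) g) - b k| ≤ A + |Λ k (Fin.last k)| * g := by
    filter_upwards [Ioc_mem_nhdsGT hγ] with g hg
    have h := abs_sub_le_sum_of_anchor_of_histLipschitz hL hb k (update_last_mem_box (mem_box.2 (hadm k)) hg)
    rw [Fin.sum_univ_castSucc, Function.update_self] at h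
    have hsum : ∑ i : Fin k, |Λ k (Fin.castSucc i)| * Function.update (v₀ k) (Fin.last k) g (Fin.castSucc i) = A :=
      Finset.sum_congr rfl fun i _ => by rw [Function.update_of_ne (Fin.castSucc_lt_last i).ne]
    rwa [hsum] at h
  have h1 : Tendsto (fun g : ℝ => |β k (Function.update (v₀ k) (Fin.last k) g) - b k|) (𝓝[>] (0 : ℝ)) (𝓝 |beta0OfMerged β v₀ k - b k|) :=
    (ht.sub tendsto_const_nhds).abs
  have h0 : Tendsto (fun g : ℝ => g) (𝓝[>] (0 : ℝ)) (𝓝 0) := (continuous_id.tendsto 0).mono_left nhdsWithin_le_nhds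
  have h2 : Tendsto (fun g : ℝ => A + |Λ k (Fin.last k)| * g) (𝓝[>] (0 : ℝ)) (𝓝 (A + |Λ k (Fin.last k)| * 0)) :=
    tendsto_const_nhds.add (tendsto_const_nhds.mul h0)
  have h := le_of_tendsto_of_tendsto h1 h2 hev
  rwa [mul_zero, add_zero] at h

/-- **TWO ADMISSIBLE BASE HISTORIES GIVE (2.12) NUMBERS WITHIN THE EARLY-COUPLING MODULI OF THEIR DISTANCE**:
`|beta0OfMerged β v₀ k − beta0OfMerged β v₀′ k| ≤ Σ_{i<k} |Λ k i|·|v₀ k i − v₀′ k i|` (no anchor needed).  With fading memory the right side is `≤ C·θ·(1−θ)⁻¹·sup_i |v₀ k i − v₀′ k i|`-type: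
the definitional split's numbers move CONTINUOUSLY with the base history inside the window — and are undefined junk on its boundary (`v₀ := 0`, the records of record), where
nothing here applies. [cite: Balaban1987RG1, (2.12)-(2.14) p.268 and §5 p.298] -/
theorem abs_beta0OfMerged_sub_beta0OfMerged_le_of_histLipschitz (hL : HistLipschitz Λ γ β)
    {v₀ v₀' : (k : ℕ) → (Fin (k + 1) → ℝ)} (hadm : ∀ k i, 0 < v₀ k i ∧ v₀ k i ≤ γ) (hadm' : ∀ k i, 0 < v₀' k i ∧ v₀' k i ≤ γ) (k : ℕ) :
    |beta0OfMerged β v₀ k - beta0OfMerged β v₀' k| ≤ ∑ i : Fin k, |Λ k (Fin.castSucc i)| * |v₀ k (Fin.castSucc i) - v₀' k (Fin.castSucc i)| := by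
  have hγ : 0 < γ := (hadm k (Fin.last k)).1.trans_le (hadm k (Fin.last k)).2
  have ht := tendsto_beta0OfMerged β v₀ (beta0LimitExists_of_histLipschitz hL hadm) k
  have ht' := tendsto_beta0OfMerged β v₀' (beta0LimitExists_of_histLipschitz hL hadm') k
  set A : ℝ := ∑ i : Fin k, |Λ k (Fin.castSucc i)| * |v₀ k (Fin.castSucc i) - v₀' k (Fin.castSucc i)| with hA
  have hev : ∀ᶠ g in 𝓝[>] (0 : ℝ),
      |β k (Function.update (v₀ k) (Fin.last k) g) - β k (Function.update (v₀' k) (Fin.last k) g)| ≤ A := by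
    filter_upwards [Ioc_mem_nhdsGT hγ] with g hg
    have h := hL k _ _ (update_last_mem_box (mem_box.2 (hadm k)) hg) (update_last_mem_box (mem_box.2 (hadm' k)) hg)
    rw [Fin.sum_univ_castSucc, Function.update_self, Function.update_self, sub_self, abs_zero, mul_zero, add_zero] at h
    refine h.trans (Finset.sum_le_sum fun i _ => ?_)
    rw [Function.update_of_ne (Fin.castSucc_lt_last i).ne, Function.update_of_ne (Fin.castSucc_lt_last i).ne]
    exact mul_le_mul_of_nonneg_right (le_abs_self _) (abs_nonneg _)
  have h1 : Tendsto (fun g : ℝ => |β k (Function.update (v₀ k) (Fin.last k) g) - β k (Function.update (v₀' k) (Fin.last k) g)|) (𝓝[>] (0 : ℝ))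
      (𝓝 |beta0OfMerged β v₀ k - beta0OfMerged β v₀' k|) := (ht.sub ht').abs
  exact le_of_tendsto h1 hev

/-- ★ **OWN-NUMBER ANCHORING OF def-B's DESIGN ⟺ THE OFF-BOX FILL EQUALS THE CORNER** (the located sentence for K2⁷'s own-numbers keying, an4 p609486 ∕ plan g84 (A) «bOwn_k = β_k(0)»):
for the design `β′ := betaOfMerged βm β0 γ` (EQUAL to `βm` ON the box, to the fill value `β0` OFF it — at the record `β0 = beta0OfMerged βm θ.v₀`, CRIT-2 p592695's exposed object),
with `βm` history-Lipschitz on `]0, γ]` and anchored at `b`: «`β′` is per-scale anchored at its OWN zero-history values `β′_k(0) = β0_k`» holds IF AND ONLY IF `β0_k = b_k` for every `k` —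
a COINCIDENCE CONDITION on the fill value, not an estimate (←: anchors transfer along the box; →: both numbers are within `δ + S_k·t` of `βm_k(t,…,t)` for small `t`).
[cite: Balaban1987RG1, (2.12)-(2.14) p.268] -/
theorem anchor_zeroValues_betaOfMerged_iff {βm : HBeta} (hγ : 0 < γ) (hL : HistLipschitz Λ γ βm)
    (hb : ∀ (k : ℕ) (δ : ℝ), 0 < δ → ∃ γ' : ℝ, 0 < γ' ∧ ∀ p : Fin (k + 1) → ℝ, p ∈ HistBox γ' k → |βm k p - b k| ≤ δ) (β0 : ℕ → ℝ) :
    (∀ (k : ℕ) (δ : ℝ), 0 < δ → ∃ γ' : ℝ, 0 < γ' ∧ ∀ p : Fin (k + 1) → ℝ, p ∈ HistBox γ' k →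
        |betaOfMerged βm β0 γ k p - betaOfMerged βm β0 γ k (fun _ => 0)| ≤ δ) ↔ ∀ k, β0 k = b k := by
  have hzero : ∀ k, betaOfMerged βm β0 γ k (fun _ => 0) = β0 k := fun k =>
    betaOfMerged_of_notMem βm β0 γ fun hmem => lt_irrefl (0 : ℝ) ((mem_box.1 hmem) 0).1
  have hS0 : ∀ k, 0 ≤ ∑ i : Fin (k + 1), |Λ k i| := fun k => Finset.sum_nonneg fun i _ => abs_nonneg _
  constructor
  · intro hown k
    refine eq_of_forall_dist_le fun ε hε => ?_
    obtain ⟨γ', hγ', hanchor⟩ := hown k (ε / 2) (half_pos hε)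
    set S : ℝ := ∑ i : Fin (k + 1), |Λ k i| with hS
    set t : ℝ := min (min γ' γ) (ε / 2 / (S + 1)) with ht
    have ht0 : 0 < t := lt_min (lt_min hγ' hγ) (by positivity)
    have htγ' : t ≤ γ' := (min_le_left _ _).trans (min_le_left _ _)
    have htγ : t ≤ γ := (min_le_left _ _).trans (min_le_right _ _)
    have htS : t ≤ ε / 2 / (S + 1) := min_le_right _ _
    have hmemγ : (fun _ : Fin (k + 1) => t) ∈ Box γ k := const_mem_box ⟨ht0, htγ⟩
    have h1 : |βm k (fun _ => t) - β0 k| ≤ ε / 2 := by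
      have h := hanchor (fun _ => t) fun _ => ⟨ht0, htγ'⟩
      rwa [hzero k, betaOfMerged_of_mem βm β0 γ hmemγ] at h
    have h2 : |βm k (fun _ => t) - b k| ≤ S * t := by
      refine (abs_sub_le_sum_of_anchor_of_histLipschitz hL hb k hmemγ).trans (le_of_eq ?_)
      rw [Finset.sum_mul]
    have h3 : S * t ≤ ε / 2 := by
      calc S * t ≤ S * (ε / 2 / (S + 1)) := mul_le_mul_of_nonneg_left htS (hS0 k)
        _ ≤ ε / 2 := by rw [mul_div_assoc']; exact (div_le_iff₀ (by positivity)).mpr (by nlinarith [hS0 k])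
    rw [Real.dist_eq]
    calc |β0 k - b k| ≤ |βm k (fun _ => t) - β0 k| + |βm k (fun _ => t) - b k| := by
          rw [abs_sub_comm (βm k _) (β0 k)]; exact abs_sub_le _ _ _
      _ ≤ ε / 2 + ε / 2 := add_le_add h1 (h2.trans h3)
      _ = ε := add_halves ε
  · intro heq k δ hδ
    obtain ⟨γ', hγ', hanchor⟩ := anchor_congr_box (β' := betaOfMerged βm β0 γ) hγ (fun k p hp => betaOfMerged_of_mem βm β0 γ hp) hb k δ hδ
    refine ⟨γ', hγ', fun p hp => ?_⟩
    rw [hzero k, heq k]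
    exact hanchor p hp

end U2

end YMDAG.N18.CornerBandOfKernelLetters

end
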